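import Summits.ValiantsHypothesis.ValiantsHypothesis.Theorems.KPlusLogSqLawTropicalBBandedChains
import Summits.ValiantsHypothesis.ValiantsHypothesis.Theorems.KPlusLogSqLawTropicalBRelabel

/-!
# Route «KPlusLogSqLaw», crux `TropicalB` (stmt-ValiantsHypothesis-19771) — TAME TERMS ARE FEW IN EVERY CHAIN:
# in any dominant chain of any design, at most `(mK+1)·(2T_w)^{⌊log₂ m⌋+1}` terms are `w`-crossing-bounded and at most
# `(mK+1)·2^{(4u+1)(⌊log₂ m⌋+1)}` terms are `u`-banded — whatever the other terms are

HONEST FRAMING.  Helper toward the registered stubs `stub_tropThin` / `stub_tropFat` of `Cruxes/TropicalB/Lines/birth.lean` (crux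
`Summit.ValiantsHypothesis.ValiantsHypothesis.Theses.KPlusLogSqLaw.TropicalB`, item stmt-ValiantsHypothesis-19771, route KPlusLogSqLaw,
DRAFT; cell `pub-symmetroid`, seat val-sym-trop-p1 g7, 2026-08-27; `--supports … --as helper`).  A STRUCTURE theorem about dominant chains of
ARBITRARY designs; nothing here bounds `TropicalB`, and nothing bears on `TropicalB` in its window, `WeakLifting`, DoorA26 / DoorA34,
`MatrixDescartes` (stmt-ValiantsHypothesis-18050) or VP ≠ VNP.

THE POINT.  The chain theorems of …TropicalBCrossingChains / …TropicalBBandedChains ask EVERY term of the chain to be tame (crossing-bounded,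
resp. banded).  But the state-count recursion only counts restrictions of the terms satisfying the predicate `P`, and a SUB-family of a dominant
chain (re-indexed along `Finset.orderEmbOfFin`) is again a dominant chain at strictly increasing slopes with pairwise distinct terms.  Hence
the COUNTING form, valid for every chain with no hypothesis at all:

* `card_filter_le_of_states_pred` — for any predicate `P` whose present terms send column intervals onto `≤ T` row sets:
  `#{k : P (p k)} ≤ (mK+1)·(2T)^{⌊log₂ m⌋+1}`;
* `card_crossingBounded_le` — `#{k : σ_k crosses every cut ≤ w times} ≤ (mK+1)·(2((2w+1)(m+1)^{2w})²)^{⌊log₂ m⌋+1}`, and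
  `card_crossingBounded_le_two_pow`: `≤ 2^{(20w+8)(K + ⌊log₂ m⌋²)}`;
* `card_banded_le` — `#{k : |σ_k(i) − i| ≤ u ∀ i} ≤ (mK+1)·2^{(4u+1)(⌊log₂ m⌋+1)}` (polynomial: `< (mK+1)(2m)^{4u+1} + 1`);
* `card_crossingBounded_relabel_le_two_pow` — the same crossing count after ANY relabelling `σ ↦ π⁻¹ σ ρ` of rows and columns
  (`isDominant_relabel_iff`, …TropicalBRelabel): for every pair of orders at most `2^{(20w+8)(K+⌊log₂ m⌋²)}` terms are `w`-crossing-bounded.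

Reading (construction side): a chain of length `n` contains at least `n + 1 − 2^{(20w+8)(K+⌊log₂ m⌋²)}` terms crossing some cut `≥ w+1` times
and at least `n + 1 − (mK+1)·2^{(4u+1)(⌊log₂ m⌋+1)}` terms displacing some column by `> u` — under every pair of row/column orders (relabelling
invariance, tree): in a super-quasi-polynomial chain ALMOST ALL permutations are wild.  [folklore: Gusfield 1980; the sub-family bookkeeping is
this file's]
-/

set_option linter.dupNamespace false
set_option autoImplicit false

namespace Summit.ValiantsHypothesis.ValiantsHypothesis.Theorems.KPlusLogSqLaw

open Summit.ValiantsHypothesis.ValiantsHypothesis.Theorems.MatrixDescartes.Negative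
open Summit.ValiantsHypothesis.ValiantsHypothesis.Theorems.LacunarySymmetroidMatrixDescartes
open scoped BigOperators
open Finset

namespace IntervalOpt

variable {m K : ℕ} {d : Fin K → ℕ} {v ε : Fin m → Fin m → Fin K → ℤ}

/-- **Sub-families of a chain.**  The terms of a dominant chain (strictly increasing slopes, distinct consecutive terms) satisfying a
predicate `P`, re-indexed increasingly, form a dominant chain of `P`-terms at strictly increasing slopes with pairwise distinct terms; so
the state-count bound for `P`-chains bounds their NUMBER: `#{k : P (p k)} ≤ (mK+1)·(2T)^{⌊log₂ m⌋+1}`. [folklore] -/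
theorem card_filter_le_of_states_pred (P : Equiv.Perm (Fin m) × (Fin m → Fin K) → Prop) [DecidablePred fun q => P q]
    (St : ℕ → ℕ → Finset (Finset (Fin m))) (T : ℕ) (hT1 : 1 ≤ T)
    (hT : ∀ a t : ℕ, (St a t).card ≤ T)
    (hSt : ∀ p : Equiv.Perm (Fin m) × (Fin m → Fin K), termSign ε p ≠ 0 → P p → ∀ a t : ℕ, (ico m a t).image p.1 ∈ St a t)
    {n : ℕ} (θ : Fin (n + 1) → ℤ) (p : Fin (n + 1) → Equiv.Perm (Fin m) × (Fin m → Fin K)) (hθ : StrictMono θ)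
    (hdom : ∀ k, IsDominant d v ε (θ k) (p k)) (hne : ∀ k : Fin n, p k.castSucc ≠ p k.succ) :
    (Finset.univ.filter fun k => P (p k)).card ≤ (m * K + 1) * (2 * T) ^ (Nat.log 2 m + 1) := by
  classical
  set s := Finset.univ.filter fun k => P (p k) with hs
  rcases Nat.eq_zero_or_pos s.card with h0 | hpos
  · rw [h0]; exact Nat.zero_le _
  · -- re-index the sub-family along the order embedding `Fin s.card ↪o Fin (n+1)`
    obtain ⟨n', hn'⟩ : ∃ n', s.card = n' + 1 := ⟨s.card - 1, by omega⟩
    set e : Fin (n' + 1) ↪o Fin (n + 1) := s.orderEmbOfFin hn' with he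
    have hmem : ∀ j, e j ∈ s := fun j => by rw [he]; exact s.orderEmbOfFin_mem hn' j
    have hinj := injective_of_chainD d v ε θ p hθ hdom hne
    have hθ' : StrictMono (θ ∘ e) := hθ.comp e.strictMono
    have hdom' : ∀ j, IsDominant d v ε ((θ ∘ e) j) ((p ∘ e) j) := fun j => hdom (e j)
    have hne' : ∀ j : Fin n', (p ∘ e) j.castSucc ≠ (p ∘ e) j.succ := by
      intro j h
      have h1 := e.injective (hinj h)
      exact absurd (congrArg Fin.val h1) (by simp [Fin.val_succ])
    have hP' : ∀ j, P ((p ∘ e) j) := fun j => (Finset.mem_filter.1 (hmem j)).2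
    have h := chain_le_of_states_pred (d := d) (v := v) (ε := ε) P St T hT1 hT hSt (θ ∘ e) (p ∘ e) hθ' hdom' hne' hP'
    omega

open Classical in
/-- **Crossing-bounded terms are few.**  In ANY design and ANY dominant chain, the number of terms whose permutation has up-crossings
`#{i < t ≤ σ_k i} ≤ w` at every cut is at most `(mK+1)·(2((2w+1)(m+1)^{2w})²)^{⌊log₂ m⌋+1}`. [folklore] -/
theorem card_crossingBounded_le (w : ℕ) {n : ℕ} (θ : Fin (n + 1) → ℤ) (p : Fin (n + 1) → Equiv.Perm (Fin m) × (Fin m → Fin K))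
    (hθ : StrictMono θ) (hdom : ∀ k, IsDominant d v ε (θ k) (p k)) (hne : ∀ k : Fin n, p k.castSucc ≠ p k.succ) :
    (Finset.univ.filter fun k => ∀ t : ℕ,
        (Finset.univ.filter fun i : Fin m => (i : ℕ) < t ∧ t ≤ (((p k).1 i : Fin m) : ℕ)).card ≤ w).card ≤
      (m * K + 1) * (2 * ((2 * w + 1) * (m + 1) ^ (2 * w)) ^ 2) ^ (Nat.log 2 m + 1) := by
  classical
  exact card_filter_le_of_states_pred (d := d) (v := v) (ε := ε)
    (fun q => ∀ t : ℕ, (Finset.univ.filter fun i : Fin m => (i : ℕ) < t ∧ t ≤ ((q.1 i : Fin m) : ℕ)).card ≤ w)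
    (shapes m w) _ ((one_le_card_shapes (m := m) w 0 0).trans (card_shapes_le w 0 0)) (fun a t => card_shapes_le w a t)
    (fun _ _ hq a t => image_mem_shapes_of_cross hq a t) θ p hθ hdom hne

open Classical in
/-- **Crossing-bounded terms are few (exponential form).**  In any design, a dominant chain contains at most `2^{(20w+8)(K + ⌊log₂ m⌋²)}`
terms crossing every cut at most `w` times — all other terms cross some cut `≥ w + 1` times. [folklore] -/
theorem card_crossingBounded_le_two_pow (w : ℕ) (d : Fin K → ℕ) (v ε : Fin m → Fin m → Fin K → ℤ) {n : ℕ}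
    (θ : Fin (n + 1) → ℤ) (p : Fin (n + 1) → Equiv.Perm (Fin m) × (Fin m → Fin K))
    (hθ : StrictMono θ) (hdom : ∀ k, IsDominant d v ε (θ k) (p k)) (hne : ∀ k : Fin n, p k.castSucc ≠ p k.succ) :
    (Finset.univ.filter fun k => ∀ t : ℕ,
        (Finset.univ.filter fun i : Fin m => (i : ℕ) < t ∧ t ≤ (((p k).1 i : Fin m) : ℕ)).card ≤ w).card ≤
      2 ^ ((20 * w + 8) * (K + Nat.log 2 m ^ 2)) := by
  classical
  rcases Nat.eq_zero_or_pos K with hK | hK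
  · subst hK
    have h0 := tropRowD_zero m 0 d v ε n θ p hθ hdom hne
    calc _ ≤ (Finset.univ : Finset (Fin (n + 1))).card := Finset.card_filter_le _ _
      _ = n + 1 := by simp
      _ ≤ 2 ^ ((20 * w + 8) * (0 + Nat.log 2 m ^ 2)) := by
          have : 1 ≤ 2 ^ ((20 * w + 8) * (0 + Nat.log 2 m ^ 2)) := Nat.one_le_two_pow
          omega
  · exact (card_crossingBounded_le (d := d) (v := v) (ε := ε) w θ p hθ hdom hne).trans (upperBand_size_le_two_pow m K w hK)

open Classical in
/-- **… under every pair of orders.**  For ANY permutations `π` (rows) and `ρ` (columns): in a dominant chain of any design, at most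
`2^{(20w+8)(K + ⌊log₂ m⌋²)}` terms `σ_k` have the relabelled permutation `π⁻¹ σ_k ρ` crossing every cut at most `w` times (the chain
`(π⁻¹ σ_k ρ, λ_k ∘ ρ)` is a dominant chain of the relabelled design, `isDominant_relabel_iff`). [folklore] -/
theorem card_crossingBounded_relabel_le_two_pow (w : ℕ) (d : Fin K → ℕ) (v ε : Fin m → Fin m → Fin K → ℤ)
    (π ρ : Equiv.Perm (Fin m)) {n : ℕ} (θ : Fin (n + 1) → ℤ) (p : Fin (n + 1) → Equiv.Perm (Fin m) × (Fin m → Fin K))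
    (hθ : StrictMono θ) (hdom : ∀ k, IsDominant d v ε (θ k) (p k)) (hne : ∀ k : Fin n, p k.castSucc ≠ p k.succ) :
    (Finset.univ.filter fun k => ∀ t : ℕ,
        (Finset.univ.filter fun i : Fin m => (i : ℕ) < t ∧ t ≤ (((π⁻¹ * (p k).1 * ρ) i : Fin m) : ℕ)).card ≤ w).card ≤
      2 ^ ((20 * w + 8) * (K + Nat.log 2 m ^ 2)) := by
  classical
  -- the relabelled chain
  set q : Fin (n + 1) → Equiv.Perm (Fin m) × (Fin m → Fin K) := fun k => (π⁻¹ * (p k).1 * ρ, fun i => (p k).2 (ρ i)) with hq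
  have hback : ∀ k, ((π * (q k).1 * ρ⁻¹ : Equiv.Perm (Fin m)), fun j => (q k).2 (ρ⁻¹ j)) = p k := by
    intro k
    refine Prod.ext ?_ ?_
    · simp only [hq]
      ext i
      simp [Equiv.Perm.mul_apply]
    · funext j
      simp [hq]
  have hdom' : ∀ k, IsDominant d (fun a b l => v (π a) (ρ b) l) (fun a b l => ε (π a) (ρ b) l) (θ k) (q k) := by
    intro k
    rw [← isDominant_relabel_iff d v ε π ρ (q k) (θ k), hback k]
    exact hdom k
  have hne' : ∀ k : Fin n, q k.castSucc ≠ q k.succ := by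
    intro k h
    apply hne k
    rw [← hback k.castSucc, ← hback k.succ, h]
  exact card_crossingBounded_le_two_pow w d _ _ θ q hθ hdom' hne'

/-- **Banded terms are polynomially few.**  In ANY design and ANY dominant chain, the number of terms whose permutation has bandwidth `≤ u`
(`σ_k i ≤ i + u` and `i ≤ σ_k i + u` for all `i`) is at most `(mK+1)·2^{(4u+1)(⌊log₂ m⌋+1)}` (`< (mK+1)(2m)^{4u+1} + 1` for `m ≥ 1`). [folklore] -/
theorem card_banded_le (u : ℕ) {n : ℕ} (θ : Fin (n + 1) → ℤ) (p : Fin (n + 1) → Equiv.Perm (Fin m) × (Fin m → Fin K))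
    (hθ : StrictMono θ) (hdom : ∀ k, IsDominant d v ε (θ k) (p k)) (hne : ∀ k : Fin n, p k.castSucc ≠ p k.succ) :
    (Finset.univ.filter fun k => ∀ i : Fin m,
        (((p k).1 i : Fin m) : ℕ) ≤ (i : ℕ) + u ∧ (i : ℕ) ≤ (((p k).1 i : Fin m) : ℕ) + u).card ≤
      (m * K + 1) * 2 ^ ((4 * u + 1) * (Nat.log 2 m + 1)) := by
  classical
  have h := card_filter_le_of_states_pred (d := d) (v := v) (ε := ε)
    (fun q => ∀ i : Fin m, ((q.1 i : Fin m) : ℕ) ≤ (i : ℕ) + u ∧ (i : ℕ) ≤ ((q.1 i : Fin m) : ℕ) + u)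
    (bandShapes m u) (2 ^ (2 * u) * 2 ^ (2 * u)) (Nat.one_le_iff_ne_zero.2 (by positivity)) (fun a t => card_bandShapes_le u a t)
    (fun _ _ hq a t => image_mem_bandShapes hq a t) θ p hθ hdom hne
  have he : 2 * (2 ^ (2 * u) * 2 ^ (2 * u)) = 2 ^ (4 * u + 1) := by
    rw [← pow_add, ← pow_succ']; ring_nf
  rw [he, ← pow_mul] at h
  exact h

/-- **Banded terms are polynomially few (explicit degree).**  For `m ≥ 1`: fewer than `(mK+1)(2m)^{4u+1} + 1` terms of any dominant chain
of any design of format `(m, K)` are `u`-banded. [folklore] -/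
theorem card_banded_lt_poly (u : ℕ) (hm : 1 ≤ m) {n : ℕ} (θ : Fin (n + 1) → ℤ)
    (p : Fin (n + 1) → Equiv.Perm (Fin m) × (Fin m → Fin K))
    (hθ : StrictMono θ) (hdom : ∀ k, IsDominant d v ε (θ k) (p k)) (hne : ∀ k : Fin n, p k.castSucc ≠ p k.succ) :
    (Finset.univ.filter fun k => ∀ i : Fin m,
        (((p k).1 i : Fin m) : ℕ) ≤ (i : ℕ) + u ∧ (i : ℕ) ≤ (((p k).1 i : Fin m) : ℕ) + u).card <
      (m * K + 1) * (2 * m) ^ (4 * u + 1) + 1 := by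
  have h := card_banded_le (d := d) (v := v) (ε := ε) u θ p hθ hdom hne
  have hL : 2 ^ (Nat.log 2 m + 1) ≤ 2 * m := by
    rw [pow_succ]
    have := Nat.pow_log_le_self 2 (by omega : m ≠ 0)
    omega
  have h2 : 2 ^ ((4 * u + 1) * (Nat.log 2 m + 1)) ≤ (2 * m) ^ (4 * u + 1) := by
    rw [mul_comm, pow_mul]
    exact Nat.pow_le_pow_left hL _
  have h3 := Nat.mul_le_mul_left (m * K + 1) h2
  omega

end IntervalOpt

end Summit.ValiantsHypothesis.ValiantsHypothesis.Theorems.KPlusLogSqLaw
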